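import Literature.Analysis.Calculus.ConeCube
import Literature.Analysis.Calculus.BoxStokes
import HarnessLib

/-!
# Cone periods of a closed form are a cocycle

For a differential `k`-form `ω` on a real normed space `W` with values in a complete normed space `F`,
differentiable with `dω = 0` on an open CONVEX set `X`, and points `x₀, …, x_{k+1} ∈ X`, the periods of
`ω` over the straight `k`-simplices (cone-cubes, `Literature/Analysis/Calculus/ConeCube.lean`) spanned
by the faces of `[x₀, …, x_{k+1}]` satisfy the simplicial cocycle identity

  `∑ᵢ (-1)ⁱ conePeriod k ω (x ∘ Fin.succAbove i) = 0`      (`conePeriod_cocycle`).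

Proof: Stokes' theorem on the unit cube `[0,1]^{k+1}` (`integral_extDeriv_Icc_eq_sum_faces_of_differentiableOn`,
`BoxStokes.lean`) for the pulled-back form `η = κ*ω`, `κ = coneCube (k+1) x`: `dη = κ*(dω) = 0`
(Mathlib `extDeriv_pullback`), and the faces of the cube are identified by the face lemmas of
`ConeCube.lean` — `tᵢ = 1` is the cone-cube with `xᵢ` deleted, `t_k = 0` the one with `x_{k+1}` deleted,
and the faces `tᵢ = 0`, `i < k`, are degenerate (a zero tangent vector, so the alternating integrand
vanishes).  This is the analytic heart of the explicit de Rham → group-cohomology map by integration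
over straight simplices (Dupont; Eichler–Shimura; the Eisenstein cocycles of Sczech), here for an
arbitrary closed form on a convex open set: combined with the equivariance of cone-cubes under linear
maps (`coneCube_comp_linear`) it makes `(g₀, …, g_k) ↦ conePeriod k ω (gᵢ • x₀)` a homogeneous group
cocycle for every closed form equivariant under a linear action preserving `X`.

Theorems only (no definitions, no named facts).

## References

* J. L. Dupont, *Simplicial de Rham cohomology and characteristic classes of flat bundles*,
  Topology 15 (1976), 233–245, §1–2. [Dupont1976]
* M. Spivak, *Calculus on Manifolds*, Benjamin 1965, Thm. 4-13. [Spivak1965]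
* R. Sczech, Comment. Math. Helv. 67 (1992), 363–382, §1–2. [Sczech1992]
-/

noncomputable section

open Set MeasureTheory

namespace Literature.Analysis.Calculus

/-! ### The cocycle identity -/

section Cocycle

variable {W : Type*} [NormedAddCommGroup W] [NormedSpace ℝ W]
  {F : Type*} [NormedAddCommGroup F] [NormedSpace ℝ F] [CompleteSpace F]

omit [CompleteSpace F] in
/-- Evaluation of a pulled-back form: `(f*ω)(t)(v) = ω(f t)(Df(t) v₀, …)`. [folklore] -/
theorem pullback_apply {E : Type*} [NormedAddCommGroup E] [NormedSpace ℝ E] {k : ℕ}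
    (ω : W → W [⋀^Fin k]→L[ℝ] F) (f : E → W) (t : E) (v : Fin k → E) :
    (ω (f t)).compContinuousLinearMap (fderiv ℝ f t) v = ω (f t) (fun j => fderiv ℝ f t (v j)) :=
  rfl

/-- **Cone periods of a closed form are a cocycle.**  For a `k`-form `ω`, differentiable with
`dω = 0` on an open convex set `X`, and points `x₀, …, x_{k+1} ∈ X`, the alternating sum of the cone
periods of `ω` over the faces of the straight simplex `[x₀, …, x_{k+1}]` vanishes:
`∑ᵢ (-1)ⁱ ∫_{[x₀,…,x̂ᵢ,…,x_{k+1}]} ω = 0` — Stokes on the unit cube `[0,1]^{k+1}` for the pulled-back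
form `κ*ω` (`dκ*ω = κ*dω = 0`), whose cube faces are: `tᵢ = 1` ↦ the cone-cube with `xᵢ` deleted,
`t_k = 0` ↦ the cone-cube with `x_{k+1}` deleted, `tᵢ = 0` (`i < k`) ↦ degenerate.
[cite: Dupont1976, §1–2] [cite: Spivak1965, Thm. 4-13] -/
theorem conePeriod_cocycle {X : Set W} (hXo : IsOpen X) (hXc : Convex ℝ X) (k : ℕ)
    (ω : W → W [⋀^Fin k]→L[ℝ] F) (hω : DifferentiableOn ℝ ω X)
    (hclosed : ∀ y ∈ X, extDeriv ω y = 0) (x : Fin (k + 2) → W) (hx : ∀ i, x i ∈ X) :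
    ∑ i : Fin (k + 2), (-1 : ℝ) ^ (i : ℕ) • conePeriod k ω (fun j => x (i.succAbove j)) = 0 := by
  set κ : (Fin (k + 1) → ℝ) → W := coneCube (k + 1) x with hκ
  set U : Set (Fin (k + 1) → ℝ) := κ ⁻¹' X with hU
  have hUo : IsOpen U := hXo.preimage (continuous_coneCube _ _)
  have hsub : Icc (0 : Fin (k + 1) → ℝ) 1 ⊆ U := fun t ht =>
    coneCube_mem_of_convex hXc _ hx fun j => ⟨ht.1 j, ht.2 j⟩
  set η : (Fin (k + 1) → ℝ) → (Fin (k + 1) → ℝ) [⋀^Fin k]→L[ℝ] F :=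
    fun t => (ω (κ t)).compContinuousLinearMap (fderiv ℝ κ t) with hη
  -- `κ` is smooth, `η` is differentiable on `U`
  have hκ2 : ContDiff ℝ 2 κ := contDiff_coneCube _ _
  have hdκ : Differentiable ℝ (fderiv ℝ κ) :=
    (hκ2.fderiv_right le_rfl).differentiable one_ne_zero
  have hωd : ∀ t ∈ U, DifferentiableAt ℝ ω (κ t) := fun t ht =>
    (hω _ ht).differentiableAt (hXo.mem_nhds ht)
  have hηd : DifferentiableOn ℝ η U := fun t ht => by
    have h1 : DifferentiableAt ℝ (fun s => ω (κ s)) t :=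
      (hωd t ht).comp t (differentiable_coneCube _ _ t)
    exact (h1.hasFDerivAt.continuousAlternatingMapCompContinuousLinearMap
      (hdκ t).hasFDerivAt).differentiableAt.differentiableWithinAt
  -- `dη = κ* dω = 0` on `U`
  have hdη : ∀ t ∈ U, extDeriv η t = 0 := fun t ht => by
    have h2 : minSmoothness ℝ 2 ≤ (2 : WithTop ℕ∞) := by simp
    have := extDeriv_pullback (ω := ω) (f := κ) (x := t) (hωd t ht) hκ2.contDiffAt h2
    rw [hη, this, hclosed _ ht]
    ext v
    rfl
  -- Stokes on the cube `[0,1]^{k+1}`; the left-hand side vanishes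
  have hint : IntegrableOn (fun t => extDeriv η t (fun l => Pi.single l 1))
      (Icc (0 : Fin (k + 1) → ℝ) 1) :=
    integrableOn_zero.congr_fun (fun t ht => by rw [hdη t (hsub ht)]; rfl) measurableSet_Icc
  have hst := integral_extDeriv_Icc_eq_sum_faces_of_differentiableOn 0 1 zero_le_one η hUo hsub
    hηd hint
  have hL : ∫ t in Icc (0 : Fin (k + 1) → ℝ) 1, extDeriv η t (fun l => Pi.single l 1) = 0 :=
    setIntegral_eq_zero_of_forall_eq_zero fun t ht => by rw [hdη t (hsub ht)]; rfl
  rw [hL] at hst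
  -- the front faces `tᵢ = 1`: cone periods with `xᵢ` deleted
  have hfront : ∀ i : Fin (k + 1),
      (∫ y in Icc ((0 : Fin (k + 1) → ℝ) ∘ i.succAbove) ((1 : Fin (k + 1) → ℝ) ∘ i.succAbove),
        η (i.insertNth ((1 : Fin (k + 1) → ℝ) i) y) (fun j => Pi.single (i.succAbove j) 1)) =
        conePeriod k ω (fun j => x ((Fin.castSucc i).succAbove j)) := by
    intro i
    have h0 : ((0 : Fin (k + 1) → ℝ) ∘ i.succAbove) = 0 := rfl
    have h1 : ((1 : Fin (k + 1) → ℝ) ∘ i.succAbove) = 1 := rfl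
    rw [h0, h1, conePeriod_def]
    refine setIntegral_congr_fun measurableSet_Icc fun y _ => ?_
    simp only [hη, Pi.one_apply, hκ, coneCube_insertNth_one,
      ContinuousAlternatingMap.compContinuousLinearMap_apply, Function.comp_def,
      fderiv_coneCube_insertNth_one]
  -- the back faces `tᵢ = 0`: degenerate for `i < k`, the cone period with `x_{k+1}` deleted for `i = k`
  have hback : ∀ i : Fin (k + 1),
      (∫ y in Icc ((0 : Fin (k + 1) → ℝ) ∘ i.succAbove) ((1 : Fin (k + 1) → ℝ) ∘ i.succAbove),
        η (i.insertNth ((0 : Fin (k + 1) → ℝ) i) y) (fun j => Pi.single (i.succAbove j) 1)) =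
        if i = Fin.last k then conePeriod k ω (fun j => x ((Fin.last (k + 1)).succAbove j))
        else 0 := by
    intro i
    have h0 : ((0 : Fin (k + 1) → ℝ) ∘ i.succAbove) = 0 := rfl
    have h1 : ((1 : Fin (k + 1) → ℝ) ∘ i.succAbove) = 1 := rfl
    rw [h0, h1]
    split_ifs with hi
    · subst hi
      rw [conePeriod_def]
      refine setIntegral_congr_fun measurableSet_Icc fun y _ => ?_
      simp only [hη, Pi.zero_apply, hκ, Fin.insertNth_last', Fin.succAbove_last,
        coneCube_snoc_zero, ContinuousAlternatingMap.compContinuousLinearMap_apply,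
        Function.comp_def, fderiv_coneCube_snoc_zero]
    · refine setIntegral_eq_zero_of_forall_eq_zero fun y _ => ?_
      have hik : (i : ℕ) < k := lt_of_le_of_ne (Nat.lt_succ_iff.mp i.2) fun h =>
        hi (Fin.ext (by simp [h]))
      set j : Fin k := ⟨i, hik⟩ with hj
      have hsucc : (i : ℕ) < (i.succAbove j : ℕ) := by
        rw [Fin.succAbove_of_le_castSucc i j (le_of_eq (Fin.ext rfl))]
        simp [hj]
      have hzero : fderiv ℝ κ (i.insertNth ((0 : Fin (k + 1) → ℝ) i) y)
          (Pi.single (i.succAbove j) 1) = 0 := by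
        refine fderiv_coneCube_eq_zero_of_apply_eq_zero (k + 1) x _ i (i.succAbove j) ?_ hsucc
        simp
      simp only [hη, pullback_apply]
      exact (ω _).map_coord_zero j hzero
  -- assemble: `0 = ∑ᵢ (-1)ⁱ (Fᵢ - Bᵢ)` and reindex the target over `Fin (k+1) ⊕ {last}`
  simp only [hfront, hback, smul_sub, Finset.sum_sub_distrib, smul_ite, smul_zero,
    Finset.sum_ite_eq', Finset.mem_univ, if_true] at hst
  rw [Fin.sum_univ_castSucc]
  simp only [Fin.val_castSucc, Fin.val_last]
  rw [pow_succ, mul_neg_one, neg_smul, ← sub_eq_add_neg]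
  exact hst.symm

end Cocycle

end Literature.Analysis.Calculus

end
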